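import Summits.SmoothPoincare4.SmoothPoincare4.Theses.EntropyRung
import Summits.SmoothPoincare4.SmoothPoincare4.Theorems.EntropyRungSubcylindricalExistenceEntropyLocalisation
import Mathlib.MeasureTheory.Integral.Bochner.Basic
import Mathlib.Analysis.SpecialFunctions.Pow.Real
import Mathlib.Analysis.SpecialFunctions.Log.NegMulLog
import HarnessLib

/-!
# Energy bound for sub-zero test functions and the cut-off cost (line `green-blowup-conformal-entropy`,
# crux `EntropyRung.SubcylindricalExistence`, stmt-SmoothPoincare4-10871; helpers for Stub D)

Two elementary measure-theoretic inequalities used by the lead's assembly `stub_conformalGluing`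
(reshape R-c2) to pay the localisation cost of the logarithmic cut-offs WITHOUT a Hardy inequality.
Write `c = (4πτ)⁻²`, weights `ψ > 0` (conformal factor), `r ≥ 0` (curvature weight), a test
function `w` with `∫ c w² ψ⁴ dV = 1`, the quadratic quantity `B = ∫ (6ψ²|∇w|² + ψ⁴ r w²) dV` and
the weighted Perelman functional `E(w) = ∫ [τ(r w² + 4ψ⁻²|∇w|²) − w² log w² − 4w²] c ψ⁴ dV`.

* `entropy_le_log`: `∫ w² log w² · cψ⁴ ≤ log (c ∫ w⁴ψ⁴)` (the pointwise inequality
  `s log s ≤ s log t + s²/t − s`; no Jensen, zeros of `w` allowed).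
* `energy_bound_of_neg`: if a Yamabe–Sobolev inequality `Y √(∫ w⁴ψ⁴) ≤ B` holds and `E(w) < 0`,
  then `τ · c B ≤ 3(4 + 2 log(4π) − 2 log Y) + 6 log 6 − 6` — relevant test functions (those below
  the negative target level) have Dirichlet energy `O(1/τ)`, uniformly in the metric.
* `cutoffCost_le`: Cauchy–Schwarz `∫ c w² ψ² Q ≤ c √(∫ w⁴ψ⁴) √(∫ Q²)` for a continuous `Q ≥ 0`
  (the sum of the cut-off gradient squares), and its combination with the two facts above:
  `4τ ∫ c w²ψ²Q ≤ (4/Y)(3(4 + 2log(4π) − 2log Y) + 6log 6 − 6) √(∫ Q²)`.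

References: Perelman 2002 §3.1 (the functional); Topping 2006 Lemma 8.1.8 (the Jensen/Sobolev
pattern, here replaced by a pointwise bound). Everything is proved; no definitions, no named facts.
-/

noncomputable section

set_option linter.dupNamespace false

open scoped Manifold ContDiff Topology ENNReal
open Set MeasureTheory
open Literature.Geometry.Lorentzian

namespace Summit.SmoothPoincare4.SmoothPoincare4.Theorems

namespace GluingEnergyBound

/-- `s log s ≤ s log t + s²/t − s` for `s ≥ 0`, `t > 0` (from `log(s/t) ≤ s/t − 1`). [folklore] -/
theorem mul_log_le {s t : ℝ} (hs : 0 ≤ s) (ht : 0 < t) :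
    s * Real.log s ≤ s * Real.log t + s ^ 2 / t - s := by
  rcases hs.eq_or_lt with h | h
  · rw [← h]; simp
  · have h1 : Real.log (s / t) ≤ s / t - 1 := Real.log_le_sub_one_of_pos (div_pos h ht)
    rw [Real.log_div h.ne' ht.ne'] at h1
    have h2 : s * (Real.log s - Real.log t) ≤ s * (s / t - 1) := mul_le_mul_of_nonneg_left h1 hs
    have h3 : s * (s / t - 1) = s ^ 2 / t - s := by ring
    linarith

/-- `2 log X ≤ X/3 + 2 log 6 − 2` for `X > 0` (tangent line of the concave `log` at `6`). [folklore] -/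
theorem two_mul_log_le {X : ℝ} (hX : 0 < X) : 2 * Real.log X ≤ X / 3 + 2 * Real.log 6 - 2 := by
  have h1 : Real.log (X / 6) ≤ X / 6 - 1 := Real.log_le_sub_one_of_pos (by positivity)
  rw [Real.log_div hX.ne' (by norm_num)] at h1
  linarith

/-- `log c = −2 log(4π) − 2 log τ` for `c = (4πτ)^{−4/2}`, `τ > 0`. [folklore] -/
theorem log_normConst {τ : ℝ} (hτ : 0 < τ) :
    Real.log ((4 * Real.pi * τ) ^ (-(4 : ℝ) / 2)) = -2 * Real.log (4 * Real.pi) - 2 * Real.log τ := by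
  have h4π : 0 < 4 * Real.pi := by positivity
  rw [Real.log_rpow (by positivity), Real.log_mul h4π.ne' hτ.ne']
  ring

section Manifold

variable {M : Type} [TopologicalSpace M] [T2Space M] [SecondCountableTopology M]
  [ChartedSpace (EuclideanSpace ℝ (Fin 4)) M] [IsManifold (𝓡 4) ∞ M] [CompactSpace M]
  [T3Space M] [MeasurableSpace M] [BorelSpace M]
  (g : PseudoRiemannianMetric (𝓡 4) ∞ (EuclideanSpace ℝ (Fin 4)) (TangentSpace (𝓡 4) : M → Type _))

omit [T2Space M] [SecondCountableTopology M] in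
/-- If `∫ c w² ψ⁴ dV = 1` then `∫ w⁴ ψ⁴ dV > 0`. [folklore] -/
theorem integral_pow_four_pos (hg : g.IsRiemannian) {c : ℝ} {w ψ : M → ℝ} (hw : Continuous w)
    (hψ : Continuous ψ)
    (hnorm : ∫ x, c * (w x) ^ 2 * (ψ x) ^ 4 ∂(riemannianMeasure (g.toContMDiffRiemannianMetric hg)) = 1) :
    0 < ∫ x, (w x) ^ 4 * (ψ x) ^ 4 ∂(riemannianMeasure (g.toContMDiffRiemannianMetric hg)) := by
  set μ : Measure M := riemannianMeasure (g.toContMDiffRiemannianMetric hg) with hμ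
  have hint : Integrable (fun x ↦ (w x) ^ 4 * (ψ x) ^ 4) μ :=
    EntropyLocalisation.integrable_of_continuous g hg ((hw.pow 4).mul (hψ.pow 4))
  have hnn : 0 ≤ ∫ x, (w x) ^ 4 * (ψ x) ^ 4 ∂μ := integral_nonneg fun x ↦ by positivity
  rcases hnn.eq_or_lt with h | h
  · exfalso
    have hae : (fun x ↦ (w x) ^ 4 * (ψ x) ^ 4) =ᵐ[μ] 0 :=
      (integral_eq_zero_iff_of_nonneg (fun x ↦ by positivity) hint).1 h.symm
    have hae' : (fun x ↦ c * (w x) ^ 2 * (ψ x) ^ 4) =ᵐ[μ] fun _ ↦ (0 : ℝ) := by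
      filter_upwards [hae] with x hx
      have hx' : (w x) ^ 4 * (ψ x) ^ 4 = 0 := hx
      have h2 : (w x * ψ x) ^ 4 = 0 := by rw [mul_pow]; exact hx'
      have h3 : w x * ψ x = 0 := pow_eq_zero_iff (by norm_num) |>.1 h2
      have : (w x) ^ 2 * (ψ x) ^ 4 = (w x * ψ x) ^ 2 * (ψ x) ^ 2 := by ring
      rw [mul_assoc, this, h3]
      simp
    rw [integral_congr_ae hae', integral_zero] at hnorm
    exact zero_ne_one hnorm
  · exact h

omit [T2Space M] [SecondCountableTopology M] in
/-- **Entropy bound without Jensen.** For `c > 0`, continuous `w, ψ` with `∫ c w² ψ⁴ dV = 1`: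
`∫ w² log w² · c ψ⁴ dV ≤ log (c ∫ w⁴ ψ⁴ dV)` (integrate `s log s ≤ s log t + s²/t − s` with `s = w²`,
`t = c ∫ w⁴ψ⁴`). [folklore] -/
theorem entropy_le_log (hg : g.IsRiemannian) {c : ℝ} (hc : 0 < c) {w ψ : M → ℝ} (hw : Continuous w)
    (hψ : Continuous ψ)
    (hnorm : ∫ x, c * (w x) ^ 2 * (ψ x) ^ 4 ∂(riemannianMeasure (g.toContMDiffRiemannianMetric hg)) = 1) :
    ∫ x, (w x) ^ 2 * Real.log ((w x) ^ 2) * (c * (ψ x) ^ 4)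
        ∂(riemannianMeasure (g.toContMDiffRiemannianMetric hg)) ≤
      Real.log (c * ∫ x, (w x) ^ 4 * (ψ x) ^ 4 ∂(riemannianMeasure (g.toContMDiffRiemannianMetric hg))) := by
  set μ : Measure M := riemannianMeasure (g.toContMDiffRiemannianMetric hg) with hμ
  set I4 : ℝ := ∫ x, (w x) ^ 4 * (ψ x) ^ 4 ∂μ with hI4
  have hI4pos : 0 < I4 := integral_pow_four_pos g hg hw hψ hnorm
  set t : ℝ := c * I4 with ht
  have htpos : 0 < t := mul_pos hc hI4pos
  -- pointwise bound
  have hpt : ∀ x, (w x) ^ 2 * Real.log ((w x) ^ 2) * (c * (ψ x) ^ 4) ≤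
      Real.log t * (c * (w x) ^ 2 * (ψ x) ^ 4) + (c / t) * ((w x) ^ 4 * (ψ x) ^ 4)
        - c * (w x) ^ 2 * (ψ x) ^ 4 := by
    intro x
    have h := mul_log_le (sq_nonneg (w x)) htpos
    have hcψ : 0 ≤ c * (ψ x) ^ 4 := by positivity
    have h2 := mul_le_mul_of_nonneg_right h hcψ
    have h3 : ((w x) ^ 2 * Real.log t + ((w x) ^ 2) ^ 2 / t - (w x) ^ 2) * (c * (ψ x) ^ 4) =
        Real.log t * (c * (w x) ^ 2 * (ψ x) ^ 4) + (c / t) * ((w x) ^ 4 * (ψ x) ^ 4)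
          - c * (w x) ^ 2 * (ψ x) ^ 4 := by
      field_simp
    linarith
  -- integrability
  have hwl : Continuous fun x ↦ (w x) ^ 2 * Real.log ((w x) ^ 2) :=
    Real.continuous_mul_log.comp (hw.pow 2)
  have iL : Integrable (fun x ↦ (w x) ^ 2 * Real.log ((w x) ^ 2) * (c * (ψ x) ^ 4)) μ :=
    EntropyLocalisation.integrable_of_continuous g hg (hwl.mul (continuous_const.mul (hψ.pow 4)))
  have iN : Integrable (fun x ↦ c * (w x) ^ 2 * (ψ x) ^ 4) μ :=
    EntropyLocalisation.integrable_of_continuous g hg ((continuous_const.mul (hw.pow 2)).mul (hψ.pow 4))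
  have i4 : Integrable (fun x ↦ (w x) ^ 4 * (ψ x) ^ 4) μ :=
    EntropyLocalisation.integrable_of_continuous g hg ((hw.pow 4).mul (hψ.pow 4))
  have iN1 : Integrable (fun x ↦ Real.log t * (c * (w x) ^ 2 * (ψ x) ^ 4)) μ := iN.const_mul _
  have i41 : Integrable (fun x ↦ (c / t) * ((w x) ^ 4 * (ψ x) ^ 4)) μ := i4.const_mul _
  have iS : Integrable (fun x ↦ Real.log t * (c * (w x) ^ 2 * (ψ x) ^ 4)
      + (c / t) * ((w x) ^ 4 * (ψ x) ^ 4)) μ := iN1.add i41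
  have iR : Integrable (fun x ↦ Real.log t * (c * (w x) ^ 2 * (ψ x) ^ 4)
      + (c / t) * ((w x) ^ 4 * (ψ x) ^ 4) - c * (w x) ^ 2 * (ψ x) ^ 4) μ := iS.sub iN
  calc ∫ x, (w x) ^ 2 * Real.log ((w x) ^ 2) * (c * (ψ x) ^ 4) ∂μ
      ≤ ∫ x, (Real.log t * (c * (w x) ^ 2 * (ψ x) ^ 4) + (c / t) * ((w x) ^ 4 * (ψ x) ^ 4)
          - c * (w x) ^ 2 * (ψ x) ^ 4) ∂μ := integral_mono iL iR hpt
    _ = Real.log t * 1 + (c / t) * I4 - 1 := by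
        rw [integral_sub iS iN, integral_add iN1 i41, integral_const_mul, integral_const_mul, hnorm]
    _ = Real.log t := by
        rw [ht]
        field_simp
        ring

omit [T2Space M] [SecondCountableTopology M] in
/-- **Energy bound for sub-zero test functions.** With `c = (4πτ)^{−4/2}`, `ψ > 0`, `r ≥ 0`,
`Gw ≥ 0` (the gradient square of `w`) continuous, `∫ c w² ψ⁴ = 1`, a Yamabe–Sobolev inequality
`Y √(∫ w⁴ψ⁴) ≤ B := ∫ (6ψ²Gw + ψ⁴ r w²)` and a NEGATIVE weighted functional
`E(w) = ∫ [τ(r w² + 4ψ⁻²Gw) − w² log w² − 4w²] c ψ⁴ < 0` (`Gw` continuous; its sign is not used), one has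
`τ · c · B ≤ 3(4 + 2 log(4π) − 2 log Y) + 6 log 6 − 6`. Proof: `E ≥ (2/3)τcB − log(B²c/Y² · c⁻²…)`,
precisely `E ≥ (2/3)X − 2 log X − 2 log(4π) + 2 log Y − 4` with `X = τ c B` (`entropy_le_log` and the
Sobolev bound), and `2 log X ≤ X/3 + 2 log 6 − 2`. [cite: Topping2006, Lemma 8.1.8] -/
theorem energy_bound_of_neg (hg : g.IsRiemannian) {τ Y : ℝ} (hτ : 0 < τ) (hY : 0 < Y)
    {w ψ r Gw : M → ℝ} (hw : Continuous w) (hψ : Continuous ψ) (hr : Continuous r) (hGw : Continuous Gw)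
    (hψpos : ∀ x, 0 < ψ x) (hr0 : ∀ x, 0 ≤ r x)
    (hnorm : ∫ x, (4 * Real.pi * τ) ^ (-(4 : ℝ) / 2) * (w x) ^ 2 * (ψ x) ^ 4
      ∂(riemannianMeasure (g.toContMDiffRiemannianMetric hg)) = 1)
    (hYS : Y * Real.sqrt (∫ x, (w x) ^ 4 * (ψ x) ^ 4 ∂(riemannianMeasure (g.toContMDiffRiemannianMetric hg))) ≤
      ∫ x, (6 * ((ψ x) ^ 2 * Gw x) + (ψ x) ^ 4 * r x * (w x) ^ 2)
        ∂(riemannianMeasure (g.toContMDiffRiemannianMetric hg)))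
    (hE : ∫ x, (τ * (r x * (w x) ^ 2 + 4 * ((ψ x)⁻¹ ^ 2 * Gw x)) - (w x) ^ 2 * Real.log ((w x) ^ 2)
        - 4 * (w x) ^ 2) * ((4 * Real.pi * τ) ^ (-(4 : ℝ) / 2) * (ψ x) ^ 4)
        ∂(riemannianMeasure (g.toContMDiffRiemannianMetric hg)) < 0) :
    τ * ((4 * Real.pi * τ) ^ (-(4 : ℝ) / 2) *
        ∫ x, (6 * ((ψ x) ^ 2 * Gw x) + (ψ x) ^ 4 * r x * (w x) ^ 2)
          ∂(riemannianMeasure (g.toContMDiffRiemannianMetric hg))) ≤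
      3 * (4 + 2 * Real.log (4 * Real.pi) - 2 * Real.log Y) + 6 * Real.log 6 - 6 := by
  set μ : Measure M := riemannianMeasure (g.toContMDiffRiemannianMetric hg) with hμ
  set c : ℝ := (4 * Real.pi * τ) ^ (-(4 : ℝ) / 2) with hc
  have hcpos : 0 < c := Real.rpow_pos_of_pos (by positivity) _
  set I4 : ℝ := ∫ x, (w x) ^ 4 * (ψ x) ^ 4 ∂μ with hI4
  set B : ℝ := ∫ x, (6 * ((ψ x) ^ 2 * Gw x) + (ψ x) ^ 4 * r x * (w x) ^ 2) ∂μ with hB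
  have hnorm' : ∫ x, c * (w x) ^ 2 * (ψ x) ^ 4 ∂μ = 1 := hnorm
  have hI4pos : 0 < I4 := integral_pow_four_pos g hg hw hψ hnorm'
  have hsqrt : 0 < Real.sqrt I4 := Real.sqrt_pos.2 hI4pos
  have hBpos : 0 < B := lt_of_lt_of_le (mul_pos hY hsqrt) hYS
  -- integrability of the pieces of `E`
  have hψinv : Continuous fun x ↦ (ψ x)⁻¹ := hψ.inv₀ fun x ↦ (hψpos x).ne'
  have hquad : Continuous fun x ↦ (r x * (w x) ^ 2 + 4 * ((ψ x)⁻¹ ^ 2 * Gw x)) * (c * (ψ x) ^ 4) :=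
    ((hr.mul (hw.pow 2)).add (continuous_const.mul ((hψinv.pow 2).mul hGw))).mul
      (continuous_const.mul (hψ.pow 4))
  have hwl : Continuous fun x ↦ (w x) ^ 2 * Real.log ((w x) ^ 2) :=
    Real.continuous_mul_log.comp (hw.pow 2)
  have iQ : Integrable (fun x ↦ (r x * (w x) ^ 2 + 4 * ((ψ x)⁻¹ ^ 2 * Gw x)) * (c * (ψ x) ^ 4)) μ :=
    EntropyLocalisation.integrable_of_continuous g hg hquad
  have iL : Integrable (fun x ↦ (w x) ^ 2 * Real.log ((w x) ^ 2) * (c * (ψ x) ^ 4)) μ :=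
    EntropyLocalisation.integrable_of_continuous g hg (hwl.mul (continuous_const.mul (hψ.pow 4)))
  have iN : Integrable (fun x ↦ c * (w x) ^ 2 * (ψ x) ^ 4) μ :=
    EntropyLocalisation.integrable_of_continuous g hg ((continuous_const.mul (hw.pow 2)).mul (hψ.pow 4))
  have iB : Integrable (fun x ↦ 6 * ((ψ x) ^ 2 * Gw x) + (ψ x) ^ 4 * r x * (w x) ^ 2) μ :=
    EntropyLocalisation.integrable_of_continuous g hg
      ((continuous_const.mul ((hψ.pow 2).mul hGw)).add (((hψ.pow 4).mul hr).mul (hw.pow 2)))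
  -- split `E = τ A − Ent − 4`
  set A : ℝ := ∫ x, (r x * (w x) ^ 2 + 4 * ((ψ x)⁻¹ ^ 2 * Gw x)) * (c * (ψ x) ^ 4) ∂μ with hA
  set Ent : ℝ := ∫ x, (w x) ^ 2 * Real.log ((w x) ^ 2) * (c * (ψ x) ^ 4) ∂μ with hEnt
  have hEsplit : ∫ x, (τ * (r x * (w x) ^ 2 + 4 * ((ψ x)⁻¹ ^ 2 * Gw x)) - (w x) ^ 2 * Real.log ((w x) ^ 2)
        - 4 * (w x) ^ 2) * (c * (ψ x) ^ 4) ∂μ = τ * A - Ent - 4 := by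
    have hpt : (fun x ↦ (τ * (r x * (w x) ^ 2 + 4 * ((ψ x)⁻¹ ^ 2 * Gw x)) - (w x) ^ 2 * Real.log ((w x) ^ 2)
        - 4 * (w x) ^ 2) * (c * (ψ x) ^ 4)) = fun x ↦
        τ * ((r x * (w x) ^ 2 + 4 * ((ψ x)⁻¹ ^ 2 * Gw x)) * (c * (ψ x) ^ 4))
          - (w x) ^ 2 * Real.log ((w x) ^ 2) * (c * (ψ x) ^ 4) - 4 * (c * (w x) ^ 2 * (ψ x) ^ 4) := by
      funext x; ring
    have i1 : Integrable (fun x ↦ τ * ((r x * (w x) ^ 2 + 4 * ((ψ x)⁻¹ ^ 2 * Gw x)) * (c * (ψ x) ^ 4))) μ :=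
      iQ.const_mul τ
    have i2 : Integrable (fun x ↦ τ * ((r x * (w x) ^ 2 + 4 * ((ψ x)⁻¹ ^ 2 * Gw x)) * (c * (ψ x) ^ 4))
        - (w x) ^ 2 * Real.log ((w x) ^ 2) * (c * (ψ x) ^ 4)) μ := i1.sub iL
    have i3 : Integrable (fun x ↦ 4 * (c * (w x) ^ 2 * (ψ x) ^ 4)) μ := iN.const_mul 4
    rw [hpt, integral_sub i2 i3, integral_sub i1 iL, integral_const_mul, integral_const_mul, hnorm']
    ring
  -- (1) `A ≥ (2/3) c B`
  have hA : 2 / 3 * (c * B) ≤ A := by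
    rw [hB, ← integral_const_mul, ← integral_const_mul]
    refine integral_mono ((iB.const_mul c).const_mul _) iQ fun x ↦ ?_
    have hψx := hψpos x
    have hψne : ψ x ≠ 0 := hψx.ne'
    have hkey : (r x * (w x) ^ 2 + 4 * ((ψ x)⁻¹ ^ 2 * Gw x)) * (c * (ψ x) ^ 4)
        - 2 / 3 * (c * (6 * ((ψ x) ^ 2 * Gw x) + (ψ x) ^ 4 * r x * (w x) ^ 2))
        = 1 / 3 * (c * ((ψ x) ^ 4 * (r x * (w x) ^ 2))) := by
      field_simp
      ring
    have hnn : 0 ≤ 1 / 3 * (c * ((ψ x) ^ 4 * (r x * (w x) ^ 2))) := by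
      have := hr0 x; positivity
    linarith
  -- (2) `Ent ≤ log (B² /(c Y²))`
  have hEnt1 : Ent ≤ Real.log (c * I4) := entropy_le_log g hg hcpos hw hψ hnorm'
  have hI4le : Real.sqrt I4 ≤ B / Y := by
    rw [le_div_iff₀ hY]; linarith [hYS, mul_comm Y (Real.sqrt I4)]
  have hI4le' : I4 ≤ (B / Y) ^ 2 := by
    have h := pow_le_pow_left₀ hsqrt.le hI4le 2
    rwa [Real.sq_sqrt hI4pos.le] at h
  have hEnt2 : Ent ≤ Real.log c + 2 * Real.log B - 2 * Real.log Y := by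
    have h1 : Real.log (c * I4) ≤ Real.log (c * (B / Y) ^ 2) :=
      Real.log_le_log (mul_pos hcpos hI4pos) (mul_le_mul_of_nonneg_left hI4le' hcpos.le)
    have h2 : Real.log (c * (B / Y) ^ 2) = Real.log c + 2 * Real.log B - 2 * Real.log Y := by
      rw [Real.log_mul hcpos.ne' (by positivity), Real.log_pow, Real.log_div hBpos.ne' hY.ne']
      push_cast
      ring
    linarith
  -- (3) combine
  have hlogc : Real.log c = -2 * Real.log (4 * Real.pi) - 2 * Real.log τ := log_normConst hτ
  set X : ℝ := τ * (c * B) with hX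
  have hXpos : 0 < X := mul_pos hτ (mul_pos hcpos hBpos)
  have hlogX : Real.log X = Real.log τ + Real.log c + Real.log B := by
    rw [hX, Real.log_mul hτ.ne' (mul_pos hcpos hBpos).ne', Real.log_mul hcpos.ne' hBpos.ne']
    ring
  have hE' : τ * A - Ent - 4 < 0 := by rw [← hEsplit]; exact hE
  have h23 : 2 / 3 * X - 2 * Real.log X - 2 * Real.log (4 * Real.pi) + 2 * Real.log Y - 4 < 0 := by
    have hτA : 2 / 3 * X ≤ τ * A := by
      have := mul_le_mul_of_nonneg_left hA hτ.le
      rw [hX]; linarith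
    rw [hlogX, hlogc]
    nlinarith [hEnt2, hτA, hE', hlogc]
  have hlog := two_mul_log_le hXpos
  change X ≤ _
  linarith

omit [T2Space M] [SecondCountableTopology M] in
/-- **Cut-off cost by Cauchy–Schwarz.** For continuous `w, ψ` and a continuous `Q ≥ 0`,
`∫ c w² ψ² Q dV ≤ c √(∫ w⁴ψ⁴ dV) √(∫ Q² dV)` (`c ≥ 0`). In the assembly `Q = |∇χ₁|²_g + |∇χ₂|²_g`
and the left side is `∫ c w² (|∇χ₁|² + |∇χ₂|²)_{ψ²g} dV_{ψ²g}`; `∫ Q² dV_g` is conformally invariant in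
dimension four. [folklore] -/
theorem cutoffCost_le (hg : g.IsRiemannian) {c : ℝ} (hc : 0 ≤ c) {w ψ Q : M → ℝ} (hw : Continuous w)
    (hψ : Continuous ψ) (hQ : Continuous Q) (hQ0 : ∀ x, 0 ≤ Q x) :
    ∫ x, c * (w x) ^ 2 * (ψ x) ^ 2 * Q x ∂(riemannianMeasure (g.toContMDiffRiemannianMetric hg)) ≤
      c * Real.sqrt (∫ x, (w x) ^ 4 * (ψ x) ^ 4 ∂(riemannianMeasure (g.toContMDiffRiemannianMetric hg))) *
        Real.sqrt (∫ x, (Q x) ^ 2 ∂(riemannianMeasure (g.toContMDiffRiemannianMetric hg))) := by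
  set μ : Measure M := riemannianMeasure (g.toContMDiffRiemannianMetric hg) with hμ
  haveI : IsFiniteMeasure μ := isFiniteMeasure_riemannianMeasure _
  -- Hölder with `p = q = 2` for `f = w²ψ²`, `g = Q`
  have hf : Continuous fun x ↦ (w x) ^ 2 * (ψ x) ^ 2 := (hw.pow 2).mul (hψ.pow 2)
  obtain ⟨Cf, hCf⟩ := isCompact_univ.exists_bound_of_continuousOn (f := fun x ↦ (w x) ^ 2 * (ψ x) ^ 2)
    hf.continuousOn
  obtain ⟨CQ, hCQ⟩ := isCompact_univ.exists_bound_of_continuousOn hQ.continuousOn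
  have hfm : MemLp (fun x ↦ (w x) ^ 2 * (ψ x) ^ 2) (ENNReal.ofReal 2) μ :=
    MemLp.of_bound hf.aestronglyMeasurable Cf (ae_of_all _ fun x ↦ hCf x (mem_univ x))
  have hQm : MemLp Q (ENNReal.ofReal 2) μ :=
    MemLp.of_bound hQ.aestronglyMeasurable CQ (ae_of_all _ fun x ↦ hCQ x (mem_univ x))
  have hH := integral_mul_le_Lp_mul_Lq_of_nonneg Real.HolderConjugate.two_two
    (ae_of_all μ fun x ↦ by positivity) (ae_of_all μ fun x ↦ hQ0 x) hfm hQm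
  have h1 : ∫ x, c * (w x) ^ 2 * (ψ x) ^ 2 * Q x ∂μ = c * ∫ x, (w x) ^ 2 * (ψ x) ^ 2 * Q x ∂μ := by
    rw [← integral_const_mul]
    refine integral_congr_ae (ae_of_all _ fun x ↦ ?_)
    ring
  have h2 : (∫ x, ((w x) ^ 2 * (ψ x) ^ 2) ^ (2 : ℝ) ∂μ) ^ (1 / (2 : ℝ)) =
      Real.sqrt (∫ x, (w x) ^ 4 * (ψ x) ^ 4 ∂μ) := by
    rw [Real.sqrt_eq_rpow]
    congr 1
    refine integral_congr_ae (ae_of_all _ fun x ↦ ?_)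
    dsimp only
    rw [show ((2 : ℝ)) = ((2 : ℕ) : ℝ) by norm_num, Real.rpow_natCast]
    ring
  have h3 : (∫ x, (Q x) ^ (2 : ℝ) ∂μ) ^ (1 / (2 : ℝ)) = Real.sqrt (∫ x, (Q x) ^ 2 ∂μ) := by
    rw [Real.sqrt_eq_rpow]
    congr 1
    refine integral_congr_ae (ae_of_all _ fun x ↦ ?_)
    dsimp only
    rw [show ((2 : ℝ)) = ((2 : ℕ) : ℝ) by norm_num, Real.rpow_natCast]
  rw [h2, h3] at hH
  rw [h1, mul_assoc]
  exact mul_le_mul_of_nonneg_left hH hc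

omit [T2Space M] [SecondCountableTopology M] in
/-- **The localisation cost is small for sub-zero test functions.** Under the hypotheses of
`energy_bound_of_neg` and for a continuous `Q ≥ 0`:
`4τ ∫ c w² ψ² Q dV ≤ (4/Y) · (3(4 + 2 log(4π) − 2 log Y) + 6 log 6 − 6) · √(∫ Q² dV)`
(`cutoffCost_le`, the Sobolev bound `c√(∫w⁴ψ⁴) ≤ cB/Y` and `τ c B ≤ C_Y`). [folklore] -/
theorem cutoffCost_le_of_neg (hg : g.IsRiemannian) {τ Y : ℝ} (hτ : 0 < τ) (hY : 0 < Y)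
    {w ψ r Gw Q : M → ℝ} (hw : Continuous w) (hψ : Continuous ψ) (hr : Continuous r) (hGw : Continuous Gw)
    (hQ : Continuous Q) (hQ0 : ∀ x, 0 ≤ Q x)
    (hψpos : ∀ x, 0 < ψ x) (hr0 : ∀ x, 0 ≤ r x)
    (hnorm : ∫ x, (4 * Real.pi * τ) ^ (-(4 : ℝ) / 2) * (w x) ^ 2 * (ψ x) ^ 4
      ∂(riemannianMeasure (g.toContMDiffRiemannianMetric hg)) = 1)
    (hYS : Y * Real.sqrt (∫ x, (w x) ^ 4 * (ψ x) ^ 4 ∂(riemannianMeasure (g.toContMDiffRiemannianMetric hg))) ≤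
      ∫ x, (6 * ((ψ x) ^ 2 * Gw x) + (ψ x) ^ 4 * r x * (w x) ^ 2)
        ∂(riemannianMeasure (g.toContMDiffRiemannianMetric hg)))
    (hE : ∫ x, (τ * (r x * (w x) ^ 2 + 4 * ((ψ x)⁻¹ ^ 2 * Gw x)) - (w x) ^ 2 * Real.log ((w x) ^ 2)
        - 4 * (w x) ^ 2) * ((4 * Real.pi * τ) ^ (-(4 : ℝ) / 2) * (ψ x) ^ 4)
        ∂(riemannianMeasure (g.toContMDiffRiemannianMetric hg)) < 0) :
    4 * τ * ∫ x, (4 * Real.pi * τ) ^ (-(4 : ℝ) / 2) * (w x) ^ 2 * (ψ x) ^ 2 * Q x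
        ∂(riemannianMeasure (g.toContMDiffRiemannianMetric hg)) ≤
      4 / Y * (3 * (4 + 2 * Real.log (4 * Real.pi) - 2 * Real.log Y) + 6 * Real.log 6 - 6) *
        Real.sqrt (∫ x, (Q x) ^ 2 ∂(riemannianMeasure (g.toContMDiffRiemannianMetric hg))) := by
  set μ : Measure M := riemannianMeasure (g.toContMDiffRiemannianMetric hg) with hμ
  set c : ℝ := (4 * Real.pi * τ) ^ (-(4 : ℝ) / 2) with hc
  have hcpos : 0 < c := Real.rpow_pos_of_pos (by positivity) _
  set B : ℝ := ∫ x, (6 * ((ψ x) ^ 2 * Gw x) + (ψ x) ^ 4 * r x * (w x) ^ 2) ∂μ with hB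
  set SQ : ℝ := Real.sqrt (∫ x, (Q x) ^ 2 ∂μ) with hSQ
  have hSQ0 : 0 ≤ SQ := Real.sqrt_nonneg _
  have hCS := cutoffCost_le g hg hcpos.le hw hψ hQ hQ0
  have hEB := energy_bound_of_neg g hg hτ hY hw hψ hr hGw hψpos hr0 hnorm hYS hE
  have h1 : c * Real.sqrt (∫ x, (w x) ^ 4 * (ψ x) ^ 4 ∂μ) ≤ c * (B / Y) := by
    refine mul_le_mul_of_nonneg_left ?_ hcpos.le
    rw [le_div_iff₀ hY]; linarith [hYS, mul_comm Y (Real.sqrt (∫ x, (w x) ^ 4 * (ψ x) ^ 4 ∂μ))]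
  calc 4 * τ * ∫ x, c * (w x) ^ 2 * (ψ x) ^ 2 * Q x ∂μ
      ≤ 4 * τ * (c * (B / Y) * SQ) := by
        refine mul_le_mul_of_nonneg_left (hCS.trans ?_) (by positivity)
        exact mul_le_mul_of_nonneg_right h1 hSQ0
    _ = 4 / Y * (τ * (c * B)) * SQ := by
        field_simp
    _ ≤ 4 / Y * (3 * (4 + 2 * Real.log (4 * Real.pi) - 2 * Real.log Y) + 6 * Real.log 6 - 6) * SQ := by
        refine mul_le_mul_of_nonneg_right ?_ hSQ0
        exact mul_le_mul_of_nonneg_left hEB (by positivity)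

end Manifold

end GluingEnergyBound

/-- **The localisation cost of sub-zero test functions** (registered sub-goal `gluingCutoffCost` of
Stub D of line `green-blowup-conformal-entropy`; ∀-form of `GluingEnergyBound.cutoffCost_le_of_neg`):
with `c = (4πτ)⁻²`, weights `ψ > 0`, `r ≥ 0`, a Yamabe–Sobolev bound with constant `Y` and a negative
weighted `𝒲`-functional, `4τ ∫ c w² ψ² Q ≤ (4/Y)(3(4 + 2log(4π) − 2log Y) + 6log 6 − 6) √(∫ Q²)` for
every continuous `Q ≥ 0`. [folklore] -/
theorem gluingCutoffCost :
    ∀ (M : Type) [TopologicalSpace M] [T2Space M] [SecondCountableTopology M]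
      [ChartedSpace (EuclideanSpace ℝ (Fin 4)) M] [IsManifold (𝓡 4) ∞ M] [CompactSpace M]
      [T3Space M] [MeasurableSpace M] [BorelSpace M]
      (g : PseudoRiemannianMetric (𝓡 4) ∞ (EuclideanSpace ℝ (Fin 4)) (TangentSpace (𝓡 4) : M → Type _))
      (hg : g.IsRiemannian) (τ Y : ℝ), 0 < τ → 0 < Y →
      ∀ (w ψ r Gw Q : M → ℝ), Continuous w → Continuous ψ → Continuous r → Continuous Gw →
      Continuous Q → (∀ x, 0 ≤ Q x) → (∀ x, 0 < ψ x) → (∀ x, 0 ≤ r x) →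
      ∫ x, (4 * Real.pi * τ) ^ (-(4 : ℝ) / 2) * (w x) ^ 2 * (ψ x) ^ 4
          ∂(riemannianMeasure (g.toContMDiffRiemannianMetric hg)) = 1 →
      Y * Real.sqrt (∫ x, (w x) ^ 4 * (ψ x) ^ 4 ∂(riemannianMeasure (g.toContMDiffRiemannianMetric hg))) ≤
        ∫ x, (6 * ((ψ x) ^ 2 * Gw x) + (ψ x) ^ 4 * r x * (w x) ^ 2)
          ∂(riemannianMeasure (g.toContMDiffRiemannianMetric hg)) →
      ∫ x, (τ * (r x * (w x) ^ 2 + 4 * ((ψ x)⁻¹ ^ 2 * Gw x)) - (w x) ^ 2 * Real.log ((w x) ^ 2)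
          - 4 * (w x) ^ 2) * ((4 * Real.pi * τ) ^ (-(4 : ℝ) / 2) * (ψ x) ^ 4)
          ∂(riemannianMeasure (g.toContMDiffRiemannianMetric hg)) < 0 →
      4 * τ * ∫ x, (4 * Real.pi * τ) ^ (-(4 : ℝ) / 2) * (w x) ^ 2 * (ψ x) ^ 2 * Q x
          ∂(riemannianMeasure (g.toContMDiffRiemannianMetric hg)) ≤
        4 / Y * (3 * (4 + 2 * Real.log (4 * Real.pi) - 2 * Real.log Y) + 6 * Real.log 6 - 6) *
          Real.sqrt (∫ x, (Q x) ^ 2 ∂(riemannianMeasure (g.toContMDiffRiemannianMetric hg))) := by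
  intro M _ _ _ _ _ _ _ _ _ g hg τ Y hτ hY w ψ r Gw Q hw hψ hr hGw hQ hQ0 hψpos hr0 hnorm hYS hE
  exact GluingEnergyBound.cutoffCost_le_of_neg g hg hτ hY hw hψ hr hGw hQ hQ0 hψpos hr0 hnorm hYS hE

end Summit.SmoothPoincare4.SmoothPoincare4.Theorems

end
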